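import Literature.IUT.HodgeTheaters.PuncturedEllipticProLModelRank
import Literature.AnabelianGeometry.AbsoluteAnabelian.AbsTopISemiAbsolute
import Literature.AnabelianGeometry.AbsoluteAnabelian.GaloisSubextensionProofs
import Literature.AnabelianGeometry.AbsoluteAnabelian.AbsTopII.EllipticAdmissible
import HarnessLib

/-!
# An infinite pro-`l` model of [IUTchI] §1, part 5: `GeomTFG` and the unique double cover (laws `hΔ`, `huniq′`)

Mochizuki, *Inter-universal Teichmüller theory I*, kurims manuscript (May 2020), §1 pp. 37–39
([IUTchI] §1 p.37) [claim: Mochizuki2012, status: disputed]; [AbsTopI] Prop. 2.2 p. 18 (the tree's F-0240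
`FundamentalExtension.GeomTFG`, abc-iut-L4). (D-0012 claim key; series status DISPUTED — WITNESS-class PROOF-ONLY
module; nothing of the series is asserted, no side is taken on [IUTchIII] Cor. 3.12.)

At the pro-`l` datum `ProLModel.datum l h5` of abc-iut-L5-d4 (`Π_C = Δ_C = ℤ_l^{ℤ/l} ⋊ (ℤ_l ⋊ ℤ/2)`, `G_k = 1`)
two binders of the Layer-5 certificate row `layer5_held_cor12_v6` hold:
* `geomTFG : (datum l h5).E.GeomTFG` — the binder `hΔ` ([AbsTopI] Prop. 2.2, F-0240): `Π_C` is topologically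
  generated by `B_0`, `a`, `ι` (`B_k = a^k B_0 a^{−k}`; closed subgroups of `ℤ_l` containing `1` are everything
  since `ℤ` is dense; every element is `(v)·a^s·ι^e`);
* `inf_deltaC_eq_of_mem_semiEllipticDoubleCoverSubgroups` — the binder `huniq′` ([AbsTopII] Cor. 3.3 (ii) side
  condition, literal shape): every member `J` of abc-iut-L4's `semiEllipticDoubleCoverSubgroups` meets `Δ_C` in
  `Π_X ∩ Δ_C` — indeed `Π_X` is the ONLY subgroup of index `2` (`2 ∈ ℤ_l^×`: everything in `Π_X` is a square).
HONEST LABEL: semi-synthetic model — consistency evidence for OUR typed binders only.  No `sorry`; symbolic prime `l`.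
-/

noncomputable section

namespace Literature.IUT.HodgeTheaters

namespace PuncturedEllipticData

namespace ProLModel

open DihedralGroup _root_.Topology Literature.AnabelianGeometry.AbsoluteAnabelian
open scoped Pointwise

variable (l : ℕ) [Fact l.Prime]

/-! ### Density of `ℤ` in `ℤ_l`, in the forms used -/

/-- A closed additive subgroup of `ℤ_l` containing `1` is everything (`ℤ` is dense). [folklore] -/
private theorem addSubgroup_eq_top_of_one_mem (L : AddSubgroup ℤ_[l]) (hL : IsClosed (L : Set ℤ_[l]))
    (h1 : (1 : ℤ_[l]) ∈ L) : L = ⊤ := by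
  rw [eq_top_iff]
  intro x _
  have hsub : Set.range (Int.cast : ℤ → ℤ_[l]) ⊆ (L : Set ℤ_[l]) := by
    rintro _ ⟨n, rfl⟩
    rw [SetLike.mem_coe, ← zsmul_one]
    exact L.zsmul_mem h1 n
  have hx : x ∈ closure (Set.range (Int.cast : ℤ → ℤ_[l])) := by
    rw [PadicInt.denseRange_intCast.closure_range]; exact Set.mem_univ x
  exact hL.closure_subset_iff.mpr hsub hx

/-- A closed subgroup of `P` containing `(v)` contains the whole line `(ℤ_l · v)`. [claim: Mochizuki2012, status: disputed] -/
theorem inN_smul_mem_of_isClosed (L : Subgroup (P l)) (hL : IsClosed (L : Set (P l))) (v : V l)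
    (hv : inN l v ∈ L) (t : ℤ_[l]) : inN l (t • v) ∈ L := by
  let f : Multiplicative ℤ_[l] →* P l :=
    { toFun := fun s => inN l (Multiplicative.toAdd s • v)
      map_one' := by rw [toAdd_one, zero_smul, inN_zero]
      map_mul' := fun s u => by rw [toAdd_mul, add_smul, inN_add] }
  have hf : Continuous f := (continuous_inl_inr_P l).1.comp
    (continuous_ofAdd.comp (continuous_pi fun m => continuous_toAdd.smul continuous_const))
  let L' : AddSubgroup ℤ_[l] := (L.comap f).toAddSubgroup'
  have hL' : IsClosed (L' : Set ℤ_[l]) := hL.preimage hf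
  have h1 : (1 : ℤ_[l]) ∈ L' := by
    change inN l (Multiplicative.toAdd (Multiplicative.ofAdd (1 : ℤ_[l])) • v) ∈ L
    rwa [toAdd_ofAdd, one_smul]
  have ht : t ∈ L' := by rw [addSubgroup_eq_top_of_one_mem l L' hL' h1]; exact AddSubgroup.mem_top t
  change inN l (Multiplicative.toAdd (Multiplicative.ofAdd t) • v) ∈ L at ht
  rwa [toAdd_ofAdd] at ht

/-! ### `Δ_C = Π_C` is topologically finitely generated -/

/-- `ι := (0, (0, ι)) ∈ P`. [claim: Mochizuki2012, status: disputed] -/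
theorem exists_generators : ∃ s : Finset (P l), (Subgroup.closure (s : Set (P l))).topologicalClosure = ⊤ := by
  classical
  let eI : P l := SemidirectProduct.inr (SemidirectProduct.inr (Multiplicative.ofAdd 1))
  refine ⟨{inN l (δ l 0), elA l 1, eI}, ?_⟩
  set L := (Subgroup.closure (({inN l (δ l 0), elA l 1, eI} : Finset (P l)) : Set (P l))).topologicalClosure
    with hL
  have hLc : IsClosed (L : Set (P l)) := Subgroup.isClosed_topologicalClosure _
  have hgen : ∀ x ∈ ({inN l (δ l 0), elA l 1, eI} : Finset (P l)), x ∈ L := fun x hx =>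
    Subgroup.le_topologicalClosure _ (Subgroup.subset_closure (by exact_mod_cast hx))
  have hB0 : inN l (δ l 0) ∈ L := hgen _ (by simp)
  have ha : elA l 1 ∈ L := hgen _ (by simp)
  have hI : eI ∈ L := hgen _ (by simp)
  -- all of `⟨a⟩ = ℤ_l`: the closed subgroup `{s : a^s ∈ L}` contains `1`
  have haAll : ∀ s : ℤ_[l], elA l s ∈ L := by
    let aHom : Multiplicative ℤ_[l] →* P l := SemidirectProduct.inr.comp SemidirectProduct.inl
    have haHom : Continuous aHom :=
      (continuous_inl_inr_P l).2.comp (Literature.AnabelianGeometry.EtaleTheta.SettingModel.Semidirect.continuous_inl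
        (isInducing_D l))
    let L' : AddSubgroup ℤ_[l] := (L.comap aHom).toAddSubgroup'
    have h1 : (1 : ℤ_[l]) ∈ L' := ha
    have := addSubgroup_eq_top_of_one_mem l L' (hLc.preimage haHom) h1
    intro s
    have hs : s ∈ L' := this ▸ AddSubgroup.mem_top s
    exact hs
  -- all of `N`: `B_k = a^k B_0 a^{-k} ∈ L`, then lines by closedness, then sums
  have hBk : ∀ k : ZMod l, inN l (δ l k) ∈ L := fun k => by
    have hk : inN l (δ l k) = elA l ((k.val : ℕ) : ℤ_[l]) * inN l (δ l 0) * (elA l ((k.val : ℕ) : ℤ_[l]))⁻¹ := by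
      rw [conj_inN, toDih_right_of_mem_PiXm l (elA_mem_PiXm l _), dact_r]
      change inN l (δ l k) = inN l (rot l (PadicInt.toZMod ((k.val : ℕ) : ℤ_[l])) (δ l 0))
      congr 1; funext m
      simp only [rot_apply, map_natCast, ZMod.natCast_zmod_val, δ_apply, sub_eq_zero]
    rw [hk]
    exact L.mul_mem (L.mul_mem (haAll _) hB0) (L.inv_mem (haAll _))
  have hN : ∀ v : V l, inN l v ∈ L := fun v => by
    induction v using Pi.single_induction with
    | zero => rw [inN_zero]; exact L.one_mem
    | add f g hf hg => rw [inN_add]; exact L.mul_mem hf hg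
    | single i t =>
      have : (Pi.single i t : V l) = t • δ l i := by
        funext m; simp only [Pi.smul_apply, δ_apply, Pi.single_apply, smul_eq_mul, mul_ite, mul_one, mul_zero]
      rw [this]; exact inN_smul_mem_of_isClosed l L hLc _ (hBk i) t
  -- every element: `g = (g.left) · a^{s} · ι^{e}`
  rw [eq_top_iff]
  intro g _
  have hdec : g = inN l (Multiplicative.toAdd g.left) * (elA l (Multiplicative.toAdd g.right.left) *
      SemidirectProduct.inr (SemidirectProduct.inr g.right.right)) := by
    change g = SemidirectProduct.inl (Multiplicative.ofAdd (Multiplicative.toAdd g.left)) *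
      (SemidirectProduct.inr (SemidirectProduct.inl (Multiplicative.ofAdd (Multiplicative.toAdd g.right.left))) *
        SemidirectProduct.inr (SemidirectProduct.inr g.right.right))
    rw [ofAdd_toAdd, ofAdd_toAdd, ← map_mul, SemidirectProduct.inl_left_mul_inr_right,
      SemidirectProduct.inl_left_mul_inr_right]
  have hιpow : SemidirectProduct.inr (SemidirectProduct.inr g.right.right) = eI ^ expo g.right.right := by
    rw [← map_pow, ← map_pow]
    congr 2
    have ht : expo g.right.right < 2 := (Multiplicative.toAdd g.right.right).val_lt
    rcases Nat.lt_succ_iff.mp ht |> Nat.le_one_iff_eq_zero_or_eq_one.mp with h | h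
    · rw [h, pow_zero]; exact toAdd_eq_zero.mp ((ZMod.val_eq_zero _).1 h)
    · rw [h, pow_one]
      apply Multiplicative.toAdd.injective
      rw [toAdd_ofAdd]
      have := ZMod.natCast_zmod_val (Multiplicative.toAdd g.right.right)
      rw [show (Multiplicative.toAdd g.right.right).val = 1 from h, Nat.cast_one] at this
      exact this.symm
  rw [hdec, hιpow]
  exact L.mul_mem (hN _) (L.mul_mem (haAll _) (L.pow_mem hI _))

/-- **`hΔ` ([AbsTopI] Prop. 2.2, F-0240 `GeomTFG`) at the pro-`l` datum: `Δ_C` is topologically finitely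
generated.** ([IUTchI] §1 p.37; [AbsTopI] Prop 2.2 p.18) [claim: Mochizuki2012, status: disputed] -/
theorem geomTFG (h5 : 5 ≤ l) : (datum l h5).E.GeomTFG := by
  change IsTopologicallyFinitelyGenerated ↥(ext l).geom
  have hP : IsTopologicallyFinitelyGenerated (P l) := ⟨exists_generators l⟩
  let f : P l →ₜ* ↥(ext l).geom :=
    { toFun := fun g => ⟨g, by rw [geom_eq_top]; trivial⟩
      map_one' := rfl
      map_mul' := fun _ _ => rfl
      continuous_toFun := continuous_induced_rng.mpr continuous_id }
  exact hP.of_surjective f fun x => ⟨x.1, Subtype.ext rfl⟩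


/-! ### `Π_X` is the unique subgroup of index `2` -/

/-- `2` is invertible in `ℤ_l` (`l ≥ 5`): some `u` has `u + u = 1`. [folklore] -/
private theorem exists_two_mul_eq_one (h5 : 5 ≤ l) : ∃ u : ℤ_[l], u + u = 1 := by
  have h2 : (2 : ZMod l) ≠ 0 := (ArrowModel.cusp_facts_of_five_le l h5).2.2.2.1
  have hu : IsUnit (2 : ℤ_[l]) := by
    by_contra hn
    have hmem : (2 : ℤ_[l]) ∈ IsLocalRing.maximalIdeal ℤ_[l] := hn
    rw [← PadicInt.ker_toZMod, RingHom.mem_ker, map_ofNat] at hmem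
    exact h2 hmem
  obtain ⟨u, hu⟩ := hu.exists_left_inv
  exact ⟨u, by rw [← two_mul, mul_comm, hu]⟩

/-- **`Π_X` is the unique subgroup of `Π_C` of index `2`** (every element of `Π_X` is a square).
[claim: Mochizuki2012, status: disputed] -/
theorem eq_PiXm_of_index_two (h5 : 5 ≤ l) {J : Subgroup (P l)} (hJ : J.index = 2) : J = PiXm l := by
  obtain ⟨u, hu⟩ := exists_two_mul_eq_one l h5
  have hsq : ∀ g : P l, g * g ∈ J := Subgroup.mul_self_mem_of_index_two hJ
  have hle : PiXm l ≤ J := fun g hg => by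
    rw [decomp_of_mem_PiXm l hg]
    refine J.mul_mem ?_ ?_
    · have : inN l (Multiplicative.toAdd g.left) = inN l (u • Multiplicative.toAdd g.left) *
          inN l (u • Multiplicative.toAdd g.left) := by rw [← inN_add, ← add_smul, hu, one_smul]
      rw [this]; exact hsq _
    · have : elA l (Multiplicative.toAdd g.right.left) = elA l (u * Multiplicative.toAdd g.right.left) *
          elA l (u * Multiplicative.toAdd g.right.left) := by rw [← elA_add, ← add_mul, hu, one_mul]
      rw [this]; exact hsq _
  have h := Subgroup.relIndex_mul_index hle
  rw [hJ, index_PiXm] at h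
  have h1 : (PiXm l).relIndex J = 1 := by omega
  exact le_antisymm (Subgroup.relIndex_eq_one.mp h1) hle

open AbsTopII in
/-- **`huniq′` at the pro-`l` datum** (literal shape of the binder of `layer5_held_cor12_v6`, `D′ := datum l h5`):
every member of `semiEllipticDoubleCoverSubgroups` ([AbsTopII] Cor. 3.3 (ii), abc-iut-L4) meets `Δ_C` in
`Π_X ∩ Δ_C`. ([IUTchI] §1 p.37; [AbsTopII] Cor 3.3 (ii) p.68) [claim: Mochizuki2012, status: disputed] -/
theorem inf_deltaC_eq_of_mem_semiEllipticDoubleCoverSubgroups (h5 : 5 ≤ l) :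
    ∀ J ∈ semiEllipticDoubleCoverSubgroups (datum l h5).E,
      J ⊓ (datum l h5).DeltaC = (datum l h5).PiX ⊓ (datum l h5).DeltaC := by
  intro J hJ
  have hJ2 : J.index = 2 := hJ.2.1
  rw [eq_PiXm_of_index_two l h5 hJ2]

end ProLModel

end PuncturedEllipticData

end Literature.IUT.HodgeTheaters
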